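import Summits.QuantumFields.BalabanUV.Beta.GAN24.InsertionWordTwoPointDecay

/-!
# `BalabanUV.Beta.GAN24.TwoVertexWordThreePointDecay` — binder row G-an2-4 ∕ (CONV-C), routes C-R6° («VALUES») × R7 («TWO CURRENCIES»), PART 204:
# THE TWO-VERTEX WORD `X_{[i,j],k} = L^{dk}Q_k(𝒢P(V_i)𝒢P(V_j)𝒢)Q_kᴴ` OF TWO LOCALISED BACKGROUNDS DECAYS IN THREE POINTS — `‖X_{[i,j],k}(x,y)‖ ≤ B·e^{−κ(distK(x,i) + distK(i,j) + distK(y,j))}`,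
# VOLUME-FREE AND LEVEL-FREE, for every pair of BOUNDED backgrounds supported near `i` and near `j` (no smoothness), with the step envelope `B′(√(L⁻¹))^k e^{−κ(…)}` for LIPSCHITZ ones.  This is
# the leg of census V196's second tadpole `tr(𝒢c⁻¹X_{ij}c⁻¹) = tr(Y X_{[i,j]})` (`∂_i∂_jc_k = X_{[i,j]} + X_{[j,i]}` in the first-order model): the decay in `distK(i,j)` is what makes that kernel
# decay at all.  PART 198's two-weight Combes–Thomas dictionary with TWO centres: `𝒢P_i𝒢P_j𝒢 = G·Y₁·Y₂`, `Y₁ = P_i𝒢` (rows near `i`), `Y₂ = P_j𝒢` (rows near `j`); `Y₂v` is near `j`, hence far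
# from `i` by `distK(i,j)` — the weights of two centres compare through the unit-lattice triangle inequality (`distK_sub_le_rho_of_rho_le`) (unit b2b-balaban-gan24-p3, gen 62; v1)

NOT IN PRINT; OUR PROOF ([folklore] bookkeeping BY NAME over PART 198 (`twoPoint_pairing_le`, `sqrt_nsq_mulVec_le_of_rows`, `rho_le_of_mulVec_ne_zero`, `conjDefect_calDalev_negRho`,
`opNorm_conjMat_firstOrder_negRho_le`, `rho_le_of_Pmodel_mul_ne_zero`), NE2's `CTAveragedTowerDecay` (`avgTow_apply_eq_pairing`, `nsq_star_Atow_le`, `opNorm_conjMat_inv_le_of_wCoercive`,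
`conjMat_mul_same`) ∕ `CTKingTowerWeights` (`tdist_ctr_bounds`, `blockOf_eq_toM_prtk`) ∕ `CTConjugatedHbd` ∕ `CTConjDefectDischarge`, PART 126 (`distK_sub_three_le_rho_of_near`,
`tdist_blockOf_le_one_of_Atow_QBlev_ne_zero`), PART 124 (`exists_admissible_rate`), PART 122 (`towerLimitRate_word`), `DecayRateInterpolation.decayRate_of_towerLimitRate`;
[Balaban1987RG1] (1.20)–(1.22) p. 264 LOCATE the one-loop shapes; nothing printed is a hypothesis).
HONEST FRAMING (cell contract, verbatim): «discharging `BetaPertH` makes Bałaban's UV stability UNCONDITIONAL — a real constructive-QFT result; it is NOT the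
continuum limit and NOT the Clay problem.»  HONEST DEPENDENCY (verbatim): «continuum YM on T⁴ ⇐ BetaPertH ∧ nine spine estimates (0/9 proved); BetaPertH ⇐
(D1) ∧ (D4) ∧ CAP+tail; G-an2-4 gates asym, D1 and NE2/3/4.»

WHAT THIS FILE PROVES (0 sorry, 0 `def`; `ρ_{k,y} = rho k y`, `c_{±}^{(y)} = conjMat κ (±ρ_{k,y}) (±ρ_{k,y})`, `X_{[i,j],k} = avgTow QBlev (L^d) (k ↦ 𝒢_kP(V₁)_k(𝒢_kP(V₂)_k𝒢_k)) k`):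
* §1 **`distK_sub_le_rho_of_rho_le`** — the weights of two centres: `ρ_{k,j}(u) ≤ c₀ ⟹ distK(i,j) − (c₀ + 4) ≤ ρ_{k,i}(u)` (unit-lattice triangle inequality through the block of `u`).
* §2 (GENERIC) **`threePoint_pairing_le`** (`|⟨u, GY₁Y₂v⟩| ≤ ‖c₊¹(G)‖‖c₋¹(Y₁)‖‖c₋²(Y₂)‖e^{−κ(R_u − c₁)}e^{−κ(R₁₂ − c₁)}e^{−κ(R_v − c₂)}‖u‖‖v‖` when `Y₁`'s rows live where
  `ρ₁ ≤ c₁`, `Y₂`'s rows where `ρ₂ ≤ c₂` and `ρ₁ ≥ R₁₂`); **`threePoint_avgTow_le`** (the averaged kernel decays in `dist(x,i) + R₁₂ + dist(y,j)` for two centres).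
* §3 **`exists_threePoint_twoVertexWord`** — `∃ κ > 0, B ≥ 0` from `(d, a, α, c₀)`: on EVERY torus, for EVERY pair of unit bonds `i, j` and EVERY pair of backgrounds with `‖V₁‖, ‖V₂‖ ≤ α`,
  `V₁^{(k)} ≠ 0 ⟹ ρ_{k,i} ≤ c₀`, `V₂^{(k)} ≠ 0 ⟹ ρ_{k,j} ≤ c₀`: `‖X_{[i,j],k}(x,y)‖ ≤ B·e^{−κ(distK(x,i) + distK(i,j) + distK(y,j))}` for all `k, x, y` — NO smoothness.
* §4 **`exists_threePoint_twoVertexWord_rate`** — (`L ≥ 2`, `d ≥ 1`) for localised `LipschitzBackground`s `V₁, V₂` (common `(α, β)`): the level envelope above AND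
  `‖(X_{[i,j],k+1} − X_{[i,j],k})(x,y)‖ ≤ B′·(√(L⁻¹))^k·e^{−κ(distK(x,i) + distK(i,j) + distK(y,j))}` (PART 122's tower rate for the word `[i,j]` interpolated in the three-point «distance»).
WHAT IT DOES NOT DO: the contraction `(i,j) ↦ tr(Y X_{[i,j]})` itself and its `ℤ^{d+1}` END (next: Tannery over the torus pair with this file's majorant and PART 199's EL₂ of the word
`[i,j]`); longer words; the indicator family.  SUPPLIER work; NEVER «G-an2-4 closed»; NOT (CONV-C), NOT D1, NOT `BetaPertH`, NOT continuum, NOT Clay.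
Records: `HOME/b2b-balaban-gan24-p3/gen62/README.md`.
-/

noncomputable section

open scoped BigOperators ComplexConjugate Matrix Matrix.Norms.L2Operator
open Filter Topology

namespace Summit.QuantumFields.BalabanUV.Beta.GAN24.TwoVertexWordThreePointDecay

open Literature.MathematicalPhysics.QuantumFieldTheory.Balaban1983to89
open Literature.MathematicalPhysics.QuantumFieldTheory.Balaban1983to89.B5Prop11Plancherel (Tor fine Cst Cst_nonneg)
open Literature.MathematicalPhysics.QuantumFieldTheory.Balaban1983to89.B5Prop11Lower (nsq nsq_nonneg)
open Literature.MathematicalPhysics.QuantumFieldTheory.Balaban1983to89.B5G183RateUnitTower (lev)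
open Literature.MathematicalPhysics.QuantumFieldTheory.Balaban1983to89.B5Blocks16 (blockOf)
open Literature.MathematicalPhysics.QuantumFieldTheory.Balaban1983to89.Beta.VectorTailsCov (tdist tdist_triangle tdist_comm)
open Summit.QuantumFields.BalabanUV.T4Continuum
open Summit.QuantumFields.BalabanUV.T4Continuum.CovariantAveragingTower (Atow avgTow)
open Summit.QuantumFields.BalabanUV.T4Continuum.BalabanAveragedTowerUnit (idx QBlev calGlev one_le_lev' opNorm_QBlev_sq_le)
open Summit.QuantumFields.BalabanUV.T4Continuum.BalabanAveragingPairing (freeTowerLaws_balaban)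
open Summit.QuantumFields.BalabanUV.T4Continuum.KingPairingPlantedLaw (calDalev calDalev_inv CJ CJ_nonneg)
open Summit.QuantumFields.BalabanUV.T4Continuum.FirstOrderBackgroundModel (LipschitzBackground Pmodel C2model perturbationLaws_firstOrder)
open Summit.QuantumFields.BalabanUV.T4Continuum.CTWeightedCoercivity (conjMat WCoercive)
open Summit.QuantumFields.BalabanUV.T4Continuum.CTAveragedTowerDecay (avgTow_apply_eq_pairing nsq_star_Atow_le opNorm_conjMat_inv_le_of_wCoercive conjMat_mul_same)
open Summit.QuantumFields.BalabanUV.T4Continuum.CTKingTowerWeights (rho rhoSite ctr toM distK rho_apply tdist_ctr_bounds blockOf_eq_toM_prtk)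
open Summit.QuantumFields.BalabanUV.T4Continuum.CTConjugatedHbd (G2 G2_nonneg wCoercive_calDa_of_conjDefect)
open Summit.QuantumFields.BalabanUV.T4Continuum.CTConjDefectDischarge (conjDefect_calDalev_rho max_JA_lt_gamD)
open Summit.QuantumFields.BalabanUV.T4Continuum.CTVectorPropagator (JA)
open Summit.QuantumFields.BalabanUV.T4Continuum.DirichletRegionTower (gamD)
open Summit.QuantumFields.BalabanUV.T4Continuum.BlockSumDecay (prtk prtQ)
open Summit.QuantumFields.BalabanUV.T4Continuum.DecayRateInterpolation (EntryDecay TwoLevelDecayRate decayRate_of_towerLimitRate)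
open Summit.QuantumFields.BalabanUV.Beta.GAN24.UnitLatticeDecayAlgebra (distK_nonneg)
open Summit.QuantumFields.BalabanUV.Beta.GAN24.InsertionChainDecay (exists_admissible_rate)
open Summit.QuantumFields.BalabanUV.Beta.GAN24.InsertionChainDecayBalaban (distK_sub_three_le_rho_of_near tdist_blockOf_le_one_of_Atow_QBlev_ne_zero)
open Summit.QuantumFields.BalabanUV.Beta.GAN24.InsertionChainLawWords (towerLimitRate_word)
open Summit.QuantumFields.BalabanUV.Beta.GAN24.InsertionWordTwoPointDecay (rho_le_of_mulVec_ne_zero sqrt_nsq_mulVec_le_of_rows twoPoint_pairing_le conjDefect_calDalev_negRho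
  opNorm_conjMat_firstOrder_negRho_le rho_le_of_Pmodel_mul_ne_zero)

/-! ## §1 The weights of two centres -/

section TwoCentres

variable {d : ℕ} (L : ℕ) [NeZero L] (M : Fin d → ℕ) [hM : ∀ μ, NeZero (M μ)]

/-- **`distK_sub_le_rho_of_rho_le` — THE CANONICAL WEIGHTS OF TWO CENTRES COMPARE THROUGH THE UNIT LATTICE** [our proof]: if the weight centred at `j` is `≤ c₀` at a fine bond `u` (so the block of
`u` is within `c₀ + 2` of `j`), then the weight centred at `i` is `≥ distK(i,j) − (c₀ + 4)` there — `tdist_ctr_bounds` at both centres and the triangle inequality through the block of `u`. -/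
theorem distK_sub_le_rho_of_rho_le (k : ℕ) (i j : idx L M 0) (u : idx L M k) {c₀ : ℝ} (hj : rho L M k j u ≤ c₀) :
    distK L M i j - (c₀ + 4) ≤ rho L M k i u := by
  have hn1 : 1 ≤ lev L k := one_le_lev' L k
  have hn : (0 : ℝ) < (lev L k : ℝ) := by exact_mod_cast hn1
  set B := toM L M (prtk (prtQ L M) k u).1 with hB
  have hbi := (tdist_ctr_bounds L M k i u).2
  have hbj := (tdist_ctr_bounds L M k j u).2
  have hbi' : (lev L k : ℝ) * (tdist (toM L M i.1) B : ℝ) ≤ (tdist (ctr L M k i) u.1 : ℝ) + ((lev L k : ℝ) - 1) := by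
    have := (Nat.cast_le (α := ℝ)).mpr hbi
    rw [Nat.cast_add, Nat.cast_mul, Nat.cast_sub hn1, Nat.cast_one] at this
    exact this
  have hbj' : (lev L k : ℝ) * (tdist (toM L M j.1) B : ℝ) ≤ (tdist (ctr L M k j) u.1 : ℝ) + ((lev L k : ℝ) - 1) := by
    have := (Nat.cast_le (α := ℝ)).mpr hbj
    rw [Nat.cast_add, Nat.cast_mul, Nat.cast_sub hn1, Nat.cast_one] at this
    exact this
  have htri : (tdist (toM L M i.1) (toM L M j.1) : ℝ) ≤ (tdist (toM L M i.1) B : ℝ) + (tdist (toM L M j.1) B : ℝ) := by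
    have h1 : tdist (toM L M i.1) (toM L M j.1) ≤ tdist (toM L M i.1) B + tdist B (toM L M j.1) := tdist_triangle _ _ _
    rw [tdist_comm B] at h1
    exact_mod_cast h1
  -- `tdist(ctr j, u) ≤ n (c₀ + 1)` from `ρ_j(u) ≤ c₀`
  have hj' : (tdist (ctr L M k j) u.1 : ℝ) ≤ (lev L k : ℝ) * (c₀ + 1) := by
    rw [rho_apply] at hj
    unfold rhoSite at hj
    rw [sub_le_iff_le_add, div_le_iff₀ hn] at hj
    linarith
  have hTi0 : (0 : ℝ) ≤ (tdist (toM L M i.1) B : ℝ) := Nat.cast_nonneg _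
  rw [distK, rho_apply]
  unfold rhoSite
  rw [le_sub_iff_add_le, le_div_iff₀ hn]
  nlinarith

end TwoCentres

/-! ## §2 Generic: the three-point pairing bound and its averaged form -/

section Generic

variable {ι : Type*} [Fintype ι] [DecidableEq ι]

/-- **`threePoint_pairing_le` — THE THREE-FACTOR PAIRING BOUND WITH TWO CENTRES** (`κ ≥ 0`): `‖conjMat κ ρ₁ ρ₁ G‖ ≤ K_G`, `‖conjMat κ (−ρ₁) (−ρ₁) Y₁‖ ≤ K₁` with `Y₁`'s rows where `ρ₁ ≤ c₁`,
`‖conjMat κ (−ρ₂) (−ρ₂) Y₂‖ ≤ K₂` with `Y₂`'s rows where `ρ₂ ≤ c₂` AND `ρ₁ ≥ R₁₂`, `u` supported where `ρ₁ ≥ R_u`, `v` where `ρ₂ ≥ R_v` ⟹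
`|⟨u, (GY₁Y₂)v⟩| ≤ K_G K₁ K₂·e^{−κ(R_u − c₁)}·e^{−κ(R₁₂ − c₁)}·e^{−κ(R_v − c₂)}·√nsq u·√nsq v` — PART 198's `twoPoint_pairing_le` against `Y₂v` (supported on `Y₂`'s rows) and
`sqrt_nsq_mulVec_le_of_rows` for `‖Y₂v‖`. [folklore] -/
theorem threePoint_pairing_le {G Y₁ Y₂ : Matrix ι ι ℂ} {κ : ℝ} (hκ : 0 ≤ κ) {ρ₁ ρ₂ : ι → ℝ} {KG K₁ K₂ Ru R₁₂ Rv c₁ c₂ : ℝ}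
    (hG : ‖conjMat κ ρ₁ ρ₁ G‖ ≤ KG) (hY₁ : ‖conjMat κ (fun e => -ρ₁ e) (fun e => -ρ₁ e) Y₁‖ ≤ K₁) (hY₁r : ∀ e e', Y₁ e e' ≠ 0 → ρ₁ e ≤ c₁)
    (hY₂ : ‖conjMat κ (fun e => -ρ₂ e) (fun e => -ρ₂ e) Y₂‖ ≤ K₂) (hY₂r : ∀ e e', Y₂ e e' ≠ 0 → ρ₂ e ≤ c₂) (h₁₂ : ∀ e e', Y₂ e e' ≠ 0 → R₁₂ ≤ ρ₁ e)
    {u v : ι → ℂ} (hu : ∀ e, u e ≠ 0 → Ru ≤ ρ₁ e) (hv : ∀ e, v e ≠ 0 → Rv ≤ ρ₂ e) :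
    ‖star u ⬝ᵥ ((G * Y₁ * Y₂) *ᵥ v)‖
      ≤ KG * K₁ * K₂ * Real.exp (-(κ * (Ru - c₁))) * Real.exp (-(κ * (R₁₂ - c₁))) * Real.exp (-(κ * (Rv - c₂))) * (Real.sqrt (nsq u) * Real.sqrt (nsq v)) := by
  have hKG : 0 ≤ KG := (norm_nonneg _).trans hG
  have hK₁ : 0 ≤ K₁ := (norm_nonneg _).trans hY₁
  rw [← Matrix.mulVec_mulVec]
  have h1 := twoPoint_pairing_le hκ hG hY₁ hY₁r (u := u) (v := Y₂ *ᵥ v) (Ru := Ru) (Rv := R₁₂) (c₀ := c₁) hu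
    (fun e he => rho_le_of_mulVec_ne_zero (ρ := fun e => -ρ₁ e) (c₀ := -R₁₂) (fun e e' h => by have := h₁₂ e e' h; linarith) v e he |> fun h => by linarith)
  have h2 := sqrt_nsq_mulVec_le_of_rows hκ hY₂ hY₂r hv
  calc ‖star u ⬝ᵥ ((G * Y₁) *ᵥ (Y₂ *ᵥ v))‖
      ≤ KG * K₁ * Real.exp (-(κ * (Ru - c₁))) * Real.exp (-(κ * (R₁₂ - c₁))) * (Real.sqrt (nsq u) * Real.sqrt (nsq (Y₂ *ᵥ v))) := h1
    _ ≤ KG * K₁ * Real.exp (-(κ * (Ru - c₁))) * Real.exp (-(κ * (R₁₂ - c₁))) * (Real.sqrt (nsq u) * (K₂ * Real.exp (-(κ * (Rv - c₂))) * Real.sqrt (nsq v))) := by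
        have h0 : 0 ≤ KG * K₁ * Real.exp (-(κ * (Ru - c₁))) * Real.exp (-(κ * (R₁₂ - c₁))) := by positivity
        exact mul_le_mul_of_nonneg_left (mul_le_mul_of_nonneg_left h2 (Real.sqrt_nonneg _)) h0
    _ = _ := by ring

variable {τ : ℕ → Type*} [∀ k, Fintype (τ k)] [∀ k, DecidableEq (τ k)]

/-- **`threePoint_avgTow_le` — THREE-POINT DECAY OF AN AVERAGED KERNEL WITH TWO CENTRES** [our proof] (any averagings `‖A_j‖² ≤ r⁻¹`, any «distance»; `κ ≥ 0`): `X_k = G·Y₁·Y₂` with the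
letters of `threePoint_pairing_le` for weights `ρ₁` (centre `i`) and `ρ₂` (centre `j`), `ρ₁ ≥ dist(x,i) − c` on the block test vector of `x` and `ρ₂ ≥ dist(y,j) − c` on that of `y`, for all
`x, y` ⟹ `‖(avgTow A r X k)(x,y)‖ ≤ K_G K₁ K₂·e^{κ(2c + 2c₁ + c₂)}·e^{κ(c₁ − R₁₂)}… packaged as `≤ K_G K₁ K₂·e^{κ(2c + 2c₁ + c₂ − R₁₂)}·e^{−κ(dist(x,i) + dist(y,j))}`. -/
theorem threePoint_avgTow_le {A : (k : ℕ) → Matrix (τ k) (τ (k + 1)) ℂ} {r : ℝ} (hr : 0 < r) (hA : ∀ k, ‖A k‖ ^ 2 ≤ r⁻¹)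
    {X : (k : ℕ) → Matrix (τ k) (τ k) ℂ} {k : ℕ} {G Y₁ Y₂ : Matrix (τ k) (τ k) ℂ} (hX : X k = G * Y₁ * Y₂) {κ KG K₁ K₂ c c₁ c₂ R₁₂ : ℝ} (hκ : 0 ≤ κ)
    {dist : τ 0 → τ 0 → ℝ} {i j : τ 0} (ρ₁ ρ₂ : τ k → ℝ)
    (hG : ‖conjMat κ ρ₁ ρ₁ G‖ ≤ KG) (hY₁ : ‖conjMat κ (fun e => -ρ₁ e) (fun e => -ρ₁ e) Y₁‖ ≤ K₁) (hY₁r : ∀ e e', Y₁ e e' ≠ 0 → ρ₁ e ≤ c₁)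
    (hY₂ : ‖conjMat κ (fun e => -ρ₂ e) (fun e => -ρ₂ e) Y₂‖ ≤ K₂) (hY₂r : ∀ e e', Y₂ e e' ≠ 0 → ρ₂ e ≤ c₂) (h₁₂ : ∀ e e', Y₂ e e' ≠ 0 → R₁₂ ≤ ρ₁ e)
    (hRi : ∀ x u, Atow A k x u ≠ 0 → dist x i - c ≤ ρ₁ u) (hRj : ∀ y u, Atow A k y u ≠ 0 → dist y j - c ≤ ρ₂ u) (x y : τ 0) :
    ‖avgTow A r X k x y‖ ≤ KG * K₁ * K₂ * Real.exp (κ * (2 * c + 2 * c₁ + c₂ - R₁₂)) * Real.exp (-(κ * (dist x i + dist y j))) := by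
  rw [avgTow_apply_eq_pairing, norm_mul, norm_pow, Complex.norm_real, Real.norm_of_nonneg hr.le, hX]
  have hKG : 0 ≤ KG := (norm_nonneg _).trans hG
  have hK₁ : 0 ≤ K₁ := (norm_nonneg _).trans hY₁
  have hK₂ : 0 ≤ K₂ := (norm_nonneg _).trans hY₂
  have hne : ∀ (z : τ 0) (u : τ k), star (Atow A k z) u ≠ 0 → Atow A k z u ≠ 0 := fun z u hu => by
    rw [Pi.star_apply] at hu
    exact fun h0 => hu (by rw [h0, star_zero])
  have hp := threePoint_pairing_le hκ hG hY₁ hY₁r hY₂ hY₂r h₁₂ (u := star (Atow A k x)) (v := star (Atow A k y)) (Ru := dist x i - c) (Rv := dist y j - c)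
    (fun u hu => hRi x u (hne x u hu)) (fun u hu => hRj y u (hne y u hu))
  have hrk : 0 < r ^ k := pow_pos hr k
  have hn : ∀ z : τ 0, Real.sqrt (nsq (star (Atow A k z))) ≤ Real.sqrt ((r ^ k)⁻¹) :=
    fun z => Real.sqrt_le_sqrt (nsq_star_Atow_le A hr hA k z)
  have hss : Real.sqrt ((r ^ k)⁻¹) * Real.sqrt ((r ^ k)⁻¹) = (r ^ k)⁻¹ := Real.mul_self_sqrt (inv_nonneg.mpr hrk.le)
  have he : Real.exp (-(κ * (dist x i - c - c₁))) * Real.exp (-(κ * (R₁₂ - c₁))) * Real.exp (-(κ * (dist y j - c - c₂)))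
      = Real.exp (κ * (2 * c + 2 * c₁ + c₂ - R₁₂)) * Real.exp (-(κ * (dist x i + dist y j))) := by
    rw [← Real.exp_add, ← Real.exp_add, ← Real.exp_add]
    congr 1
    ring
  calc r ^ k * ‖star (star (Atow A k x)) ⬝ᵥ ((G * Y₁ * Y₂) *ᵥ star (Atow A k y))‖
      ≤ r ^ k * (KG * K₁ * K₂ * Real.exp (-(κ * (dist x i - c - c₁))) * Real.exp (-(κ * (R₁₂ - c₁))) * Real.exp (-(κ * (dist y j - c - c₂)))
          * (Real.sqrt ((r ^ k)⁻¹) * Real.sqrt ((r ^ k)⁻¹))) := by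
        refine mul_le_mul_of_nonneg_left (hp.trans ?_) hrk.le
        exact mul_le_mul_of_nonneg_left (mul_le_mul (hn x) (hn y) (Real.sqrt_nonneg _) (Real.sqrt_nonneg _)) (by positivity)
    _ = KG * K₁ * K₂ * (Real.exp (-(κ * (dist x i - c - c₁))) * Real.exp (-(κ * (R₁₂ - c₁))) * Real.exp (-(κ * (dist y j - c - c₂)))) * (r ^ k * (r ^ k)⁻¹) := by
        rw [hss]; ring
    _ = KG * K₁ * K₂ * Real.exp (κ * (2 * c + 2 * c₁ + c₂ - R₁₂)) * Real.exp (-(κ * (dist x i + dist y j))) := by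
        rw [he, mul_inv_cancel₀ hrk.ne', mul_one]; ring

end Generic

/-! ## §3 Three-point decay of the two-vertex word of two bounded localised backgrounds, every torus -/

section ThreePoint

variable {d : ℕ} (L : ℕ) [NeZero L] (a : ℝ) (ha : 0 < a)

/-- **`exists_threePoint_twoVertexWord` — THE TWO-VERTEX WORD `X_{[i,j],k} = L^{dk}Q_k(𝒢P(V₁)𝒢P(V₂)𝒢)Q_kᴴ` DECAYS IN `distK(x,i) + distK(i,j) + distK(y,j)`, VOLUME-FREE AND LEVEL-FREE, FOR EVERY
PAIR OF BOUNDED LOCALISED BACKGROUNDS** [our proof] (`α ≥ 0`, `c₀` arbitrary): `∃ κ > 0, B ≥ 0` from `(d, a, α, c₀)` such that on EVERY torus, for all unit bonds `i, j`, all coefficient families with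
`‖V₁‖, ‖V₂‖ ≤ α`, `V₁^{(k)}_μ(u) ≠ 0 ⟹ ρ_{k,i}(u) ≤ c₀`, `V₂^{(k)}_μ(u) ≠ 0 ⟹ ρ_{k,j}(u) ≤ c₀`, and all `k, x, y`:
`‖X_{[i,j],k}(x,y)‖ ≤ B·e^{−κ(distK(x,i) + distK(i,j) + distK(y,j))}`.  NO smoothness of the backgrounds. -/
theorem exists_threePoint_twoVertexWord (α c₀ : ℝ) (hα : 0 ≤ α) :
    ∃ κ B : ℝ, 0 < κ ∧ 0 ≤ B ∧ ∀ (M : Fin d → ℕ) [∀ μ, NeZero (M μ)] (i j : idx L M 0) (V₁ V₂ : (k : ℕ) → Fin d → (idx L M k → ℂ)),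
      (∀ k μ u, ‖V₁ k μ u‖ ≤ α) → (∀ k μ u, ‖V₂ k μ u‖ ≤ α) →
      (∀ k μ u, V₁ k μ u ≠ 0 → rho L M k i u ≤ c₀) → (∀ k μ u, V₂ k μ u ≠ 0 → rho L M k j u ≤ c₀) →
      ∀ k x y, ‖avgTow (QBlev L M) ((L : ℝ) ^ d)
          (fun k => calGlev L M a ha k * Pmodel L M V₁ k * (calGlev L M a ha k * Pmodel L M V₂ k * calGlev L M a ha k)) k x y‖
        ≤ B * Real.exp (-(κ * (distK L M x i + distK L M i j + distK L M y j))) := by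
  obtain ⟨κ, hκ0, -, hγ', hδ', hJA⟩ := exists_admissible_rate d a
  have hJγ : max (JA d a 1 κ 1) 0 < gamD d a := max_JA_lt_gamD a hJA
  have hγw : 0 < gamD d a - max (JA d a 1 κ 1) 0 := sub_pos.mpr hJγ
  have hG2 := G2_nonneg (d := d) a (max (JA d a 1 κ 1) 0) hγw κ
  set KY : ℝ := d * (α * G2 d a (max (JA d a 1 κ 1) 0) (gamD d a - max (JA d a 1 κ 1) 0) κ) with hKY
  have hKY0 : 0 ≤ KY := by positivity
  refine ⟨κ, (gamD d a - max (JA d a 1 κ 1) 0)⁻¹ * KY * KY * Real.exp (κ * (2 * 3 + 2 * c₀ + c₀ + (c₀ + 4))), hκ0, by positivity,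
    fun M _ i j V₁ V₂ hV₁b hV₂b hloc₁ hloc₂ k x y => ?_⟩
  have hLd : (0 : ℝ) < (L : ℝ) ^ d := pow_pos (by exact_mod_cast Nat.pos_of_ne_zero (NeZero.ne L)) d
  have hW : WCoercive (calDalev L M a ha k) κ (rho L M k i) (gamD d a - max (JA d a 1 κ 1) 0) :=
    wCoercive_calDa_of_conjDefect (lev L k) (one_le_lev' L k) M a ha (conjDefect_calDalev_rho L M a ha one_pos hγ' hδ' k i)
  have hG : ‖conjMat κ (rho L M k i) (rho L M k i) (calGlev L M a ha k)‖ ≤ (gamD d a - max (JA d a 1 κ 1) 0)⁻¹ := by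
    rw [← calDalev_inv]; exact opNorm_conjMat_inv_le_of_wCoercive hW hγw
  have hY₁ : ‖conjMat κ (fun u => -rho L M k i u) (fun u => -rho L M k i u) (Pmodel L M V₁ k * calGlev L M a ha k)‖ ≤ KY := by
    rw [conjMat_mul_same, ← calDalev_inv]
    exact opNorm_conjMat_firstOrder_negRho_le L M a ha hα hV₁b (le_max_right _ _) hJγ k i (conjDefect_calDalev_negRho L M a ha one_pos hγ' hδ' k i)
  have hY₂ : ‖conjMat κ (fun u => -rho L M k j u) (fun u => -rho L M k j u) (Pmodel L M V₂ k * calGlev L M a ha k)‖ ≤ KY := by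
    rw [conjMat_mul_same, ← calDalev_inv]
    exact opNorm_conjMat_firstOrder_negRho_le L M a ha hα hV₂b (le_max_right _ _) hJγ k j (conjDefect_calDalev_negRho L M a ha one_pos hγ' hδ' k j)
  have hY₁r : ∀ e e', (Pmodel L M V₁ k * calGlev L M a ha k) e e' ≠ 0 → rho L M k i e ≤ c₀ :=
    fun e e' h => rho_le_of_Pmodel_mul_ne_zero L M (fun μ u hu => hloc₁ k μ u hu) _ e e' h
  have hY₂r : ∀ e e', (Pmodel L M V₂ k * calGlev L M a ha k) e e' ≠ 0 → rho L M k j e ≤ c₀ :=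
    fun e e' h => rho_le_of_Pmodel_mul_ne_zero L M (fun μ u hu => hloc₂ k μ u hu) _ e e' h
  have h₁₂ : ∀ e e', (Pmodel L M V₂ k * calGlev L M a ha k) e e' ≠ 0 → distK L M i j - (c₀ + 4) ≤ rho L M k i e :=
    fun e e' h => distK_sub_le_rho_of_rho_le L M k i j e (hY₂r e e' h)
  have h := threePoint_avgTow_le hLd (opNorm_QBlev_sq_le L M)
    (X := fun k => calGlev L M a ha k * Pmodel L M V₁ k * (calGlev L M a ha k * Pmodel L M V₂ k * calGlev L M a ha k))
    (G := calGlev L M a ha k) (Y₁ := Pmodel L M V₁ k * calGlev L M a ha k) (Y₂ := Pmodel L M V₂ k * calGlev L M a ha k)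
    (by simp only [Matrix.mul_assoc]) hκ0.le (dist := distK L M) (i := i) (j := j) (c := 3) (rho L M k i) (rho L M k j) hG hY₁ hY₁r hY₂ hY₂r h₁₂
    (fun x u hu => distK_sub_three_le_rho_of_near L M k x i u (tdist_blockOf_le_one_of_Atow_QBlev_ne_zero L M k x u hu))
    (fun y u hu => distK_sub_three_le_rho_of_near L M k y j u (tdist_blockOf_le_one_of_Atow_QBlev_ne_zero L M k y u hu)) x y
  refine h.trans (le_of_eq ?_)
  rw [show κ * (2 * 3 + 2 * c₀ + c₀ - (distK L M i j - (c₀ + 4))) = κ * (2 * 3 + 2 * c₀ + c₀ + (c₀ + 4)) + (-(κ * distK L M i j)) by ring, Real.exp_add,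
    show -(κ * (distK L M x i + distK L M i j + distK L M y j)) = -(κ * distK L M i j) + (-(κ * (distK L M x i + distK L M y j))) by ring, Real.exp_add]
  ring

/-! ## §4 The step envelope of the two-vertex word of two localised Lipschitz backgrounds -/

/-- **`exists_threePoint_twoVertexWord_rate` — THE LEVEL AND STEP ENVELOPES OF THE TWO-VERTEX WORD OF TWO LOCALISED LIPSCHITZ BACKGROUNDS, VOLUME-FREE** [our proof] (`L ≥ 2`, `d ≥ 1`):
`∃ κ > 0, B, B′ ≥ 0` from `(d, L, a, α, β, c₀)` such that on EVERY torus, for all unit bonds `i, j`, all `LipschitzBackground V₁ α β`, `LipschitzBackground V₂ α β` supported where `ρ_{k,i} ≤ c₀`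
resp. `ρ_{k,j} ≤ c₀`, and all `k, x, y`: `‖X_{[i,j],k}(x,y)‖ ≤ B·e^{−κD}` and `‖(X_{[i,j],k+1} − X_{[i,j],k})(x,y)‖ ≤ B′·(√(L⁻¹))^k·e^{−κD}`, `D = distK(x,i) + distK(i,j) + distK(y,j)` — §3 at every level
interpolated with PART 122's tower rate of the word `[i,j]` by `decayRate_of_towerLimitRate` in the three-point «distance». -/
theorem exists_threePoint_twoVertexWord_rate (hL : 2 ≤ L) (hd : 1 ≤ d) (α β c₀ : ℝ) :
    ∃ κ B B' : ℝ, 0 < κ ∧ 0 ≤ B ∧ 0 ≤ B' ∧ ∀ (M : Fin d → ℕ) [∀ μ, NeZero (M μ)] (i j : idx L M 0) (V₁ V₂ : (k : ℕ) → Fin d → (idx L M k → ℂ)),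
      LipschitzBackground L M V₁ α β → LipschitzBackground L M V₂ α β →
      (∀ k μ u, V₁ k μ u ≠ 0 → rho L M k i u ≤ c₀) → (∀ k μ u, V₂ k μ u ≠ 0 → rho L M k j u ≤ c₀) →
      (∀ k x y, ‖avgTow (QBlev L M) ((L : ℝ) ^ d)
          (fun k => calGlev L M a ha k * Pmodel L M V₁ k * (calGlev L M a ha k * Pmodel L M V₂ k * calGlev L M a ha k)) k x y‖
        ≤ B * Real.exp (-(κ * (distK L M x i + distK L M i j + distK L M y j)))) ∧
      (∀ k x y, ‖(avgTow (QBlev L M) ((L : ℝ) ^ d)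
          (fun k => calGlev L M a ha k * Pmodel L M V₁ k * (calGlev L M a ha k * Pmodel L M V₂ k * calGlev L M a ha k)) (k + 1)
          - avgTow (QBlev L M) ((L : ℝ) ^ d)
          (fun k => calGlev L M a ha k * Pmodel L M V₁ k * (calGlev L M a ha k * Pmodel L M V₂ k * calGlev L M a ha k)) k) x y‖
        ≤ B' * Real.sqrt ((L : ℝ)⁻¹) ^ k * Real.exp (-(κ * (distK L M x i + distK L M i j + distK L M y j)))) := by
  by_cases hαβ : 0 ≤ α ∧ 0 ≤ β
  swap
  · exact ⟨1, 0, 0, one_pos, le_rfl, le_rfl, fun M _ i j V₁ V₂ hV₁ _ _ _ => absurd hV₁.nonneg hαβ⟩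
  obtain ⟨hα, hβ⟩ := hαβ
  obtain ⟨κ, B, hκ0, hB, hUD⟩ := exists_threePoint_twoVertexWord L a ha α c₀ hα
  set κ₀ : ℝ := d * (α + β) * Cst d a with hκ₀
  set w : List Bool := [true, false] with hwdef
  set C : ℝ := ((w.length + 1) * κ₀ ^ w.length * CJ d a + w.length * κ₀ ^ (w.length - 1) * C2model d L a α β)
    + κ₀ ^ w.length * (2 * d * Cst d a + 2 * (d * L * Cst d a)) with hCdef
  have hL1 : (1 : ℝ) < L := by exact_mod_cast (lt_of_lt_of_le one_lt_two hL : 1 < L)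
  have hρ0 : (0 : ℝ) ≤ (L : ℝ)⁻¹ := inv_nonneg.mpr (Nat.cast_nonneg _)
  have hρ1 : ((L : ℝ)⁻¹) < 1 := inv_lt_one_of_one_lt₀ hL1
  have hr : (0 : ℝ) < (L : ℝ) ^ d := pow_pos (lt_trans zero_lt_one hL1) d
  have hCst := Cst_nonneg d a
  have hCJ := CJ_nonneg d a
  have hκ₀0 : 0 ≤ κ₀ := by positivity
  have hC2 : 0 ≤ C2model d L a α β := by unfold C2model; positivity
  have hC0 : 0 ≤ C := by positivity
  refine ⟨κ / 2, B, Real.sqrt (2 * B * (2 * C / (1 - (L : ℝ)⁻¹))), half_pos hκ0, hB, Real.sqrt_nonneg _, fun M _ i j V₁ V₂ hV₁ hV₂ hloc₁ hloc₂ => ?_⟩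
  -- the operator-norm tower rate of the word `[i,j]` (PART 122 on Bałaban's tower)
  have hT := towerLimitRate_word hr (freeTowerLaws_balaban L M a ha)
    (P := fun b k => Pmodel L M (if b then V₁ else V₂) k) (fun b => by cases b <;> exact perturbationLaws_firstOrder L M a ha hd (by assumption)) hκ₀0
    (fun k => mul_nonneg hC2 (pow_nonneg hρ0 k)) hρ1 (fun k => le_rfl) (fun k => le_rfl) (fun k => le_rfl) (fun k => le_rfl) w
  have e : (fun k => List.foldr (fun (b : Bool) N => (calDalev L M a ha k)⁻¹ * Pmodel L M (if b then V₁ else V₂) k * N) (calDalev L M a ha k)⁻¹ w)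
      = fun k => calGlev L M a ha k * Pmodel L M V₁ k * (calGlev L M a ha k * Pmodel L M V₂ k * calGlev L M a ha k) := by
    funext k; rw [hwdef, List.foldr_cons, List.foldr_cons, List.foldr_nil, calDalev_inv]; simp
  rw [e] at hT
  have hdec : ∀ k, EntryDecay (fun x y => distK L M x i + distK L M i j + distK L M y j)
      (avgTow (QBlev L M) ((L : ℝ) ^ d) (fun k => calGlev L M a ha k * Pmodel L M V₁ k * (calGlev L M a ha k * Pmodel L M V₂ k * calGlev L M a ha k)) k) B κ :=
    fun k x y => hUD M i j V₁ V₂ hV₁.bound hV₂.bound hloc₁ hloc₂ k x y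
  obtain ⟨clim, -, -, -, hstep⟩ := decayRate_of_towerLimitRate hρ0 hρ1 hC0 hT hdec
  refine ⟨fun k x y => (hUD M i j V₁ V₂ hV₁.bound hV₂.bound hloc₁ hloc₂ k x y).trans (mul_le_mul_of_nonneg_left (Real.exp_le_exp.mpr ?_) hB), fun k x y => hstep k x y⟩
  have h0 : 0 ≤ distK L M x i + distK L M i j + distK L M y j := add_nonneg (add_nonneg (distK_nonneg L M _ _) (distK_nonneg L M _ _)) (distK_nonneg L M _ _)
  nlinarith

end ThreePoint

end Summit.QuantumFields.BalabanUV.Beta.GAN24.TwoVertexWordThreePointDecay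

end
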